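import Summits.ResolutionOfSingularities.ResolutionOfSingularities.Theorems.PurelyInseparableDim4SpineAxisClear
import HarnessLib

/-!
# Addendum to `PIDim4.SpineAxisClear` (cell `res-dim4-pi`, CARD I-11-1, res-dim4-idea-11): crit-4's
# sharpenings (s1), (s2) of V-A4-04

[OURS · CANDIDATE · counted 0]  Def-free follow-up of `Theorems/PurelyInseparableDim4SpineAxisClear.lean`.
(s1) `Φ` drops strictly under the chart-`j` pure point move as soon as the position is `q`-fold and
`j`-CLEAR (one witness `w ∈ A` with `β_j(w) ≤ q − 1`) — axis-clearness in the other directions is not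
needed (`Phi_image_lt_of_clear`, `Phi_add_two_le_of_subset_image_of_clear`).
(s2) On ANY chart-origin point branch through `q`-fold positions (axis-clear or not, deletions allowed)
the number of clear plays among the first `L` steps satisfies `2·#clear + Φ(A_L) ≤ Φ(A_0)`
(`two_mul_card_clear_plays_le`): a would-be infinite origin branch makes only finitely many clear plays.
Statements suggested by res-dim4-crit-4 (V-A4-04); Lean by res-dim4-idea-11 (sha16 4902f1bbfd2d0dfb);
filed by res-dim4-typ-1 (header only).  Nothing here is about resolution of singularities in dimension
≥ 4 / characteristic `p`, which is NOT proved.  Supports stmt-ResolutionOfSingularities-16155 (helper).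
bears_on: LADDER-RESOLUTION:D157-DOOR2 (res-dim4-pi · I-11-1).
-/

set_option linter.dupNamespace false -- mandated namespace of this single-conjunct summit

namespace Summit.ResolutionOfSingularities.ResolutionOfSingularities.Theorems.PIDim4

namespace SpineAxisClear

open Finset Literature.AlgebraicGeometry.Resolution CentreBlowup

variable {σ : Type} [Fintype σ] [DecidableEq σ]

/-- (s1) `Φ(σ_j A) < Φ(A)` on a `q`-fold, `j`-clear position. -/
theorem Phi_image_lt_of_clear (q : ℕ) (j : σ) (A : Finset (σ →₀ ℕ)) (hA : ∀ d ∈ A, q ≤ d.degree)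
    (hC : ∃ w ∈ A, beta j w + 1 ≤ q) :
    Phi q (A.image (chartExponent q univ j)) < Phi q A := by
  unfold Phi
  rw [Finset.sum_image (chartExponent_injOn q j A hA)]
  obtain ⟨w, hw, hwq⟩ := hC
  exact Finset.sum_lt_sum (fun d hd => term_chartExponent_le q j d (hA d hd))
    ⟨w, hw, term_chartExponent_lt q j w (hA w hw) hwq⟩

/-- (s1, quantitative, deletions allowed) any `A' ⊆ σ_j(A)` has `Φ(A') + 2 ≤ Φ(A)` once `A` is
`q`-fold and `j`-clear. -/
theorem Phi_add_two_le_of_subset_image_of_clear (q : ℕ) (j : σ) (A A' : Finset (σ →₀ ℕ))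
    (hA : ∀ d ∈ A, q ≤ d.degree) (hC : ∃ w ∈ A, beta j w + 1 ≤ q)
    (hsub : A' ⊆ A.image (chartExponent q univ j)) :
    Phi q A' + 2 ≤ Phi q A := by
  have h1 : Phi q A' ≤ Phi q (A.image (chartExponent q univ j)) := by
    unfold Phi; exact Finset.sum_le_sum_of_subset hsub
  have h2 : Phi q (A.image (chartExponent q univ j)) + 2 ≤ Phi q A := by
    unfold Phi
    rw [Finset.sum_image (chartExponent_injOn q j A hA)]
    obtain ⟨w, hw, hwq⟩ := hC
    have hsplit := Finset.add_sum_erase A (fun d => (-twoE q (chartExponent q univ j d)).toNat) hw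
    have hsplit' := Finset.add_sum_erase A (fun d => (-twoE q d).toNat) hw
    have hrest : ∑ d ∈ A.erase w, (-twoE q (chartExponent q univ j d)).toNat ≤
        ∑ d ∈ A.erase w, (-twoE q d).toNat :=
      Finset.sum_le_sum fun d hd => term_chartExponent_le q j d (hA d (Finset.mem_of_mem_erase hd))
    have hw2 := term_chartExponent_add_two_le q j w (hA w hw) hwq
    rw [← hsplit, ← hsplit']
    omega
  omega

/-- (s2) On ANY chart-origin point branch through `q`-fold positions (axis-clear or not, deletions
allowed) the number of CLEAR plays (steps `t < L` at which the position is `j t`-clear) is bounded: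
`2 · #clear + Φ(A_L) ≤ Φ(A_0)`. -/
theorem two_mul_card_clear_plays_le (q : ℕ) (A : ℕ → Finset (σ →₀ ℕ)) (j : ℕ → σ) (L : ℕ)
    (h : ∀ t < L, (∀ d ∈ A t, q ≤ d.degree) ∧
      A (t + 1) ⊆ (A t).image (chartExponent q univ (j t))) :
    2 * ((Finset.range L).filter (fun t => ∃ w ∈ A t, beta (j t) w + 1 ≤ q)).card
      + Phi q (A L) ≤ Phi q (A 0) := by
  induction L with
  | zero => simp
  | succ L ih =>
    have hL := h L (Nat.lt_succ_self L)
    have ih' := ih fun t ht => h t (Nat.lt_succ_of_lt ht)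
    have hmono : Phi q (A (L + 1)) ≤ Phi q (A L) :=
      le_trans (by unfold Phi; exact Finset.sum_le_sum_of_subset hL.2) (Phi_image_le q (j L) (A L) hL.1)
    have hnot : L ∉ Finset.range L := by simp
    rw [Finset.range_add_one, Finset.filter_insert]
    by_cases hc : ∃ w ∈ A L, beta (j L) w + 1 ≤ q
    · rw [if_pos hc, Finset.card_insert_of_notMem (fun hm => hnot (Finset.mem_of_mem_filter L hm))]
      have hstep := Phi_add_two_le_of_subset_image_of_clear q (j L) (A L) (A (L + 1)) hL.1 hc hL.2
      omega
    · rw [if_neg hc]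
      omega

end SpineAxisClear

end Summit.ResolutionOfSingularities.ResolutionOfSingularities.Theorems.PIDim4
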